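import Literature.AnabelianGeometry.EtaleTheta.Discharge.Sec2ReductionLemmas

/-!
# [EtTh] §2 discharge: `Cor218_iv_reduction` (reduction `Aut(M_{M'}) → Aut(M_M)`) from
# temp-slimness and Kummer lifting — proof-only companion of `ThetaSystems.lean`

Mochizuki, *The Étale Theta Function and its Frobenioid-theoretic Manifestations* [EtTh],
Publ. RIMS 45 (2009), §2, Def 2.13 (ii) p.48, Cor 2.18 (iv) pp.61–63: "we obtain a natural
homomorphism `Aut^μ(M) → Aut^μ(M_M)`" (locators `p.N` = PDF pages of the PRIMS text; bib key
`MochizukiEtTh2009`). PROOF-ONLY companion (no `def`, no new named fact; seat abc-iut-L2-d1,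
input-discharge for the Cor 2.19 (ii) discharge `cor219_ii_of`) of `ThetaSystems.lean` (seat
abc-iut-L2-t2; nothing there is edited or restated).

`ThetaEnvTower.cor218_iv_reduction_of` — the named fact `ThetaEnvTower.Cor218_iv_reduction` HOLDS for
every tower with (a) temp-slim `Π^tp_X` ("every open subgroup has trivial centraliser", [SemiAnbd]
Ex. 3.10 — gives Cor 2.18 (iii) at every level) and (b) the KUMMER LIFTING property `KummerLift`
spelled as a hypothesis: every continuous `G_K`-inflated `μ_M`-cocycle on `Π^tp_Y` is the reduction of a
continuous `G_K`-inflated `μ_{M'}`-cocycle (in the model: `K^× ↠ H¹(G_K, μ_M)` for every `M`, the image of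
`K^×` in Def 2.13 (i); the interface `ThetaEnvTower` does not record it). Route: an automorphism of
`M_{M'}(η')` preserves the cyclotome (Cor 2.18 (iii)), acts on it by a power map, hence descends to
`Π^tp_Y[μ_M]` (`Discharge/Sec2DescentLemmas.lean`); `D_Y ↦ D_Y` descends generator by generator
(`Discharge/Sec2ReductionLemmas.lean`, Kummer generators via (b)); `[s^Θ] ↦ [s^Θ]` descends because
`red ∘ s^Θ_{η'} = s^Θ_{red ∘ η'}` and `μ_{M'}`-conjugation reduces to `μ_M`-conjugation.
HONEST FRAMING: no side is taken on [IUTchIII] Cor 3.12; typed ≠ discharged elsewhere.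
-/

namespace Literature.AnabelianGeometry.EtaleTheta

universe u

namespace ThetaEnvTower

variable {E : Set ℕ+} (T : ThetaEnvTower.{u} E)

/-- `μ_N`-conjugating the representative does not change a `μ_N`-conjugacy class (local copy of
abc-iut-L2-t10's `CycEnvelope.muConjClass_map_conj_inMu`, whose module is not yet built upstream of
this file). [cite: MochizukiEtTh2009, Def 2.10 p.44] -/
private theorem muConjClass_conj_eq {P G μ : Type*} [Group P] [Group G] [CommGroup μ]
    (aug : P →* G) (χ : G →* MulAut μ) (H : Subgroup (CycEnvelope aug χ)) (a : μ) :
    CycEnvelope.muConjClass aug χ (H.map (MulAut.conj (CycEnvelope.inMu aug χ a)).toMonoidHom) =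
      CycEnvelope.muConjClass aug χ H := by
  ext K
  constructor
  · rintro ⟨b, rfl⟩
    refine ⟨b * a, ?_⟩
    rw [Subgroup.map_map]
    congr 1
    refine MonoidHom.ext fun x => ?_
    simp only [MonoidHom.coe_comp, Function.comp_apply, MulEquiv.coe_toMonoidHom,
      MulAut.conj_apply]
    simp only [map_mul]
    group
  · rintro ⟨b, rfl⟩
    refine ⟨b * a⁻¹, ?_⟩
    rw [Subgroup.map_map]
    congr 1
    refine MonoidHom.ext fun x => ?_
    simp only [MonoidHom.coe_comp, Function.comp_apply, MulEquiv.coe_toMonoidHom,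
      MulAut.conj_apply]
    simp only [map_mul, map_inv]
    group

/-- `D_Y ↦ D_Y` descends (one inclusion): if `φ'` is an automorphism of the topological group
`Π^tp_Y[μ_{M'}]` normalising `D_Y`, reducing to `ψ` on `Π^tp_Y[μ_M]`, then `[ψ] D_Y [ψ]⁻¹ ⊆ D_Y` —
given Cor 2.18 (iii) at level `M'` and Kummer lifting `M → M'`.
[cite: MochizukiEtTh2009, Cor 2.18(iv) p.61] -/
theorem map_transport_DY_le {M M' : E} (h : (M : ℕ+) ∣ M')
    (hq' : centralizerUnion (T.level M').env =
      (CycEnvelope.proj (T.level M').augY (T.level M').chi).ker)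
    (hKL : ∀ (δ : T.G → T.mu M)
      (hδ : CycEnvelope.IsEnvCocycle (T.level M).augY (T.level M).chi (δ ∘ (T.level M).augY)),
      CycEnvelope.shift hδ ∈ contMulAut (T.level M).env →
      ∃ (δ' : T.G → T.mu M')
        (hδ' : CycEnvelope.IsEnvCocycle (T.level M').augY (T.level M').chi (δ' ∘ (T.level M').augY)),
        CycEnvelope.shift hδ' ∈ contMulAut (T.level M').env ∧ ∀ g, T.red M M' h (δ' g) = δ g)
    (φ' : (T.level M').env ≃ₜ* (T.level M').env)
    (hφ'D : (T.level M').DY.map (TopOut.transport φ') = (T.level M').DY)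
    (ψ : (T.level M).env ≃ₜ* (T.level M).env) (hψ : T.Reduces h φ'.toMulEquiv ψ.toMulEquiv) :
    (T.level M).DY.map (TopOut.transport ψ) ≤ (T.level M).DY := by
  -- it suffices to treat the generators of `D_Y` at level `M`
  rw [ThetaEnvData.DY, MonoidHom.map_closure]
  refine (Subgroup.closure_le _).mpr ?_
  -- a generator `[θ]` at level `M` that is the reduction of a generator-like `[θ']` at level `M'` with
  -- `[θ'] ∈ D_Y'` is mapped into `D_Y`
  have main : ∀ (θ : contMulAut (T.level M).env) (θ' : contMulAut (T.level M').env),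
      TopOut.mk _ θ' ∈ (T.level M').DY →
      T.Reduces h (θ' : MulAut (T.level M').env) (θ : MulAut (T.level M).env) →
      TopOut.transport ψ (TopOut.mk _ θ) ∈ (T.level M).DY := by
    intro θ θ' hθ' hred
    rw [ThetaEnvData.transport_mk]
    have hmem' : TopOut.mk _ (conjContAut φ' θ') ∈ (T.level M').DY := by
      rw [← hφ'D, ← ThetaEnvData.transport_mk]
      exact ⟨_, hθ', rfl⟩
    refine mk_mem_DY_of_reduces h hq' _ hmem' _ ?_
    have h1 : ((conjContAut φ' θ' : contMulAut (T.level M').env) : MulAut (T.level M').env) =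
        φ'.toMulEquiv * (θ' : MulAut (T.level M').env) * φ'.toMulEquiv⁻¹ :=
      MulEquiv.ext fun x => rfl
    have h2 : ((conjContAut ψ θ : contMulAut (T.level M).env) : MulAut (T.level M).env) =
        ψ.toMulEquiv * (θ : MulAut (T.level M).env) * ψ.toMulEquiv⁻¹ :=
      MulEquiv.ext fun x => rfl
    rw [h1, h2]
    exact reduces_mul (reduces_mul hψ hred) (reduces_inv hψ)
  rintro _ ⟨d, hd | hd, rfl⟩
  · -- Kummer generators: lift the cocycle to level `M'`
    obtain ⟨δ, hδ, hc, rfl⟩ := hd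
    obtain ⟨δ', hδ', hc', hδδ'⟩ := hKL δ hδ hc
    refine main ⟨_, hc⟩ ⟨_, hc'⟩
      (Subgroup.subset_closure (Set.mem_union_left _ ⟨δ', hδ', hc', rfl⟩)) ?_
    have heq : T.red M M' h ∘ (δ' ∘ (T.level M').augY) = δ ∘ (T.level M).augY :=
      funext fun g => hδδ' _
    change T.Reduces h (CycEnvelope.shift hδ') (CycEnvelope.shift hδ)
    rw [← CycEnvelope.shift_congr (T.isEnvCocycle_red_comp h hδ') hδ heq]
    exact T.reduces_shift h hδ'
  · -- `Gal(Y/X)` generators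
    obtain ⟨g, hc, rfl⟩ := hd
    exact main ⟨_, hc⟩ ⟨_, (T.level M').conjX_mem_contMulAut g⟩ ((T.level M').mk_conjX_mem_DY g)
      (T.reduces_conjX h g)

/-- `red ∘ s^Θ_{η'} = s^Θ_{red ∘ η'}`. [cite: MochizukiEtTh2009, Def 2.13(ii) p.48] -/
theorem redEnv_sTheta {M M' : E} (h : (M : ℕ+) ∣ M') {η' : T.PiYdd → T.mu M'}
    (hη' : η' ∈ T.thetaCocycles M') (g : T.PiYdd) :
    T.redEnv M M' h ((T.level M').sTheta hη' g) =
      (T.level M).sTheta (T.red_cocycle_mem M M' h η' hη') g := by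
  ext
  · simp only [left_redEnv, ThetaEnvData.sTheta, MonoidHom.coe_mk, OneHom.coe_mk, map_inv]
    rfl
  · rfl

/-- An isomorphism of model mono-theta environments `M(η) ≅ M(η')` carries `Im(s^Θ_η)` to a
`μ_N`-conjugate of `Im(s^Θ_{η'})`. [cite: MochizukiEtTh2009, Def 2.13(ii) p.48] -/
theorem _root_.Literature.AnabelianGeometry.EtaleTheta.ThetaEnvData.exists_map_range_sTheta_eq₂
    {N : ℕ+} (T : ThetaEnvData.{u} N) {η η' : T.PiYdd → T.mu} {hη : η ∈ T.thetaCocycles}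
    {hη' : η' ∈ T.thetaCocycles} (α : (T.modelMono hη).Iso (T.modelMono hη')) :
    ∃ c : T.mu, (T.sTheta hη).range.map α.e.toMulEquiv.toMonoidHom =
      (T.sTheta hη').range.map (MulAut.conj (CycEnvelope.inMu T.augY T.chi c)).toMonoidHom := by
  have h := α.map_sTheta
  change (fun H : Subgroup T.env => H.map α.e.toMulEquiv.toMonoidHom) ''
      CycEnvelope.muConjClass T.augY T.chi (T.sTheta hη).range =
    CycEnvelope.muConjClass T.augY T.chi (T.sTheta hη').range at h
  have : (T.sTheta hη).range.map α.e.toMulEquiv.toMonoidHom ∈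
      CycEnvelope.muConjClass T.augY T.chi (T.sTheta hη').range := by
    rw [← h]
    exact ⟨_, CycEnvelope.self_mem_muConjClass T.augY T.chi _, rfl⟩
  obtain ⟨c, hc⟩ := this
  exact ⟨c, hc⟩

/-- **Reduction of isomorphisms of model mono-theta environments along `μ_{M'} ↠ μ_M`**, for two
compatible cocycle families (modulo temp-slimness of `Π^tp_X` and Kummer lifting): an isomorphism
`M_{M'}(η₀') ≅ M_{M'}(η')` induces an isomorphism `M_M(red ∘ η₀') ≅ M_M(red ∘ η')`.
[cite: MochizukiEtTh2009, Cor 2.18(iv) p.61] -/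
theorem exists_iso_reduces
    (hts : ∀ U : Subgroup T.PiX, IsOpen (U : Set T.PiX) →
      ∀ z : T.PiX, (∀ u ∈ U, z * u = u * z) → z = 1)
    (hKL : ∀ (M M' : E) (h : (M : ℕ+) ∣ M') (δ : T.G → T.mu M)
      (hδ : CycEnvelope.IsEnvCocycle (T.level M).augY (T.level M).chi (δ ∘ (T.level M).augY)),
      CycEnvelope.shift hδ ∈ contMulAut (T.level M).env →
      ∃ (δ' : T.G → T.mu M')
        (hδ' : CycEnvelope.IsEnvCocycle (T.level M').augY (T.level M').chi (δ' ∘ (T.level M').augY)),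
        CycEnvelope.shift hδ' ∈ contMulAut (T.level M').env ∧ ∀ g, T.red M M' h (δ' g) = δ g)
    (M M' : E) (h : (M : ℕ+) ∣ M') (η₀' η' : T.PiYdd → T.mu M') (hη₀' : η₀' ∈ T.thetaCocycles M')
    (hη' : η' ∈ T.thetaCocycles M')
    (α' : ((T.level M').modelMono hη₀').Iso ((T.level M').modelMono hη')) :
    ∃ α : ((T.level M).modelMono (T.red_cocycle_mem M M' h η₀' hη₀')).Iso
        ((T.level M).modelMono (T.red_cocycle_mem M M' h η' hη')),
      T.Reduces h α'.e.toMulEquiv α.e.toMulEquiv := by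
  have hq : ∀ M : E, centralizerUnion (T.level M).env =
      (CycEnvelope.proj (T.level M).augY (T.level M).chi).ker := (T.cor218_iii_of_tempSlim hts).2
  -- the descent `ψ` of `α'`, and of `α'⁻¹`
  have hker := T.map_ker_eq_of_contMulAut M' (hq M') ⟨α'.e.toMulEquiv, α'.e.continuous, α'.e.symm.continuous⟩
  obtain ⟨ψ, hψ⟩ := T.exists_reduces h α'.e hker
  have hψ' : T.Reduces h α'.e.symm.toMulEquiv ψ.symm.toMulEquiv := reduces_inv hψ
  -- power maps on the cyclotomes for `ψ`, `ψ⁻¹`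
  obtain ⟨k, hk⟩ := T.exists_pow_of_map_ker M' α'.e.toMulEquiv hker
  have hk' : ∀ m : T.mu M', α'.e (CycEnvelope.inMu (T.level M').augY (T.level M').chi m) =
      CycEnvelope.inMu (T.level M').augY (T.level M').chi (m ^ k) := hk
  have hσ := T.red_surjective M M' h
  have hpow : ∀ m : T.mu M, ψ (CycEnvelope.inMu (T.level M).augY (T.level M).chi m) =
      CycEnvelope.inMu (T.level M).augY (T.level M).chi (m ^ k) := by
    intro m
    obtain ⟨m', rfl⟩ := hσ m
    have := hψ (CycEnvelope.inMu (T.level M').augY (T.level M').chi m')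
    change T.redEnv M M' h (α'.e _) = ψ (T.redEnv M M' h _) at this
    rw [hk'] at this
    have e1 : ∀ n : T.mu M', T.redEnv M M' h (CycEnvelope.inMu (T.level M').augY (T.level M').chi n) =
        CycEnvelope.inMu (T.level M).augY (T.level M).chi (T.red M M' h n) := fun n => by
      ext
      · rfl
      · rfl
    rw [e1, e1, map_zpow] at this
    exact this.symm
  have hsurj : Function.Surjective fun a : T.mu M => a ^ k := by
    intro m
    refine ⟨(ψ.symm (CycEnvelope.inMu (T.level M).augY (T.level M).chi m)).left, ?_⟩
    have h0 : CycEnvelope.inMu (T.level M).augY (T.level M).chi m ∈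
        (CycEnvelope.proj (T.level M).augY (T.level M).chi).ker := by
      rw [MonoidHom.mem_ker]; rfl
    have h1 : ψ.symm (CycEnvelope.inMu (T.level M).augY (T.level M).chi m) ∈
        (CycEnvelope.proj (T.level M).augY (T.level M).chi).ker := by
      rw [← (T.level M).map_ker_symm_of_map_ker ψ
        (T.map_ker_eq_of_contMulAut M (hq M) ⟨ψ.toMulEquiv, ψ.continuous, ψ.symm.continuous⟩)]
      exact ⟨_, h0, rfl⟩
    rw [MonoidHom.mem_ker] at h1
    have h2 : ψ.symm (CycEnvelope.inMu (T.level M).augY (T.level M).chi m) =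
        CycEnvelope.inMu (T.level M).augY (T.level M).chi
          (ψ.symm (CycEnvelope.inMu (T.level M).augY (T.level M).chi m)).left := by
      ext
      · rfl
      · exact congrArg Subtype.val h1
    have h3 := congrArg ψ h2
    rw [ContinuousMulEquiv.apply_symm_apply, hpow] at h3
    exact (SemidirectProduct.inl_injective h3).symm
  -- `[s^Θ] ↦ [s^Θ]`
  obtain ⟨c', hc'⟩ := (T.level M').exists_map_range_sTheta_eq₂ α'
  have hrange : ((T.level M).sTheta (T.red_cocycle_mem M M' h η₀' hη₀')).range.map
      ψ.toMulEquiv.toMonoidHom =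
      ((T.level M).sTheta (T.red_cocycle_mem M M' h η' hη')).range.map
        (MulAut.conj (CycEnvelope.inMu (T.level M).augY (T.level M).chi (T.red M M' h c'))).toMonoidHom := by
    have hcj := T.reduces_conj_inMu (M := M) (M' := M') (h := h) c'
    ext y
    constructor
    · rintro ⟨_, ⟨g, rfl⟩, rfl⟩
      have hin : α'.e ((T.level M').sTheta hη₀' g) ∈ ((T.level M').sTheta hη').range.map
          (MulAut.conj (CycEnvelope.inMu (T.level M').augY (T.level M').chi c')).toMonoidHom := by
        rw [← hc']; exact ⟨_, ⟨g, rfl⟩, rfl⟩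
      obtain ⟨_, ⟨g₁, rfl⟩, hg₁⟩ := hin
      refine ⟨_, ⟨g₁, rfl⟩, ?_⟩
      change MulAut.conj _ ((T.level M).sTheta _ g₁) = ψ ((T.level M).sTheta _ g)
      rw [← T.redEnv_sTheta h hη', ← T.redEnv_sTheta h hη₀', ← hcj]
      change T.redEnv M M' h (MulAut.conj _ ((T.level M').sTheta hη' g₁)) = _
      rw [show MulAut.conj _ ((T.level M').sTheta hη' g₁) = α'.e ((T.level M').sTheta hη₀' g)
        from hg₁]
      exact hψ _
    · rintro ⟨_, ⟨g, rfl⟩, rfl⟩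
      have hin : MulAut.conj (CycEnvelope.inMu (T.level M').augY (T.level M').chi c')
          ((T.level M').sTheta hη' g) ∈
          ((T.level M').sTheta hη₀').range.map α'.e.toMulEquiv.toMonoidHom := by
        rw [hc']; exact ⟨_, ⟨g, rfl⟩, rfl⟩
      obtain ⟨_, ⟨g₂, rfl⟩, hg₂⟩ := hin
      refine ⟨_, ⟨g₂, rfl⟩, ?_⟩
      change ψ ((T.level M).sTheta _ g₂) = MulAut.conj _ ((T.level M).sTheta _ g)
      rw [← T.redEnv_sTheta h hη', ← T.redEnv_sTheta h hη₀', ← hcj]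
      change _ = T.redEnv M M' h (MulAut.conj _ ((T.level M').sTheta hη' g))
      rw [show MulAut.conj _ ((T.level M').sTheta hη' g) = α'.e ((T.level M').sTheta hη₀' g₂) from
        hg₂.symm]
      exact (hψ _).symm
  refine ⟨{ e := ψ, map_D := ?_, map_sTheta := ?_ }, hψ⟩
  · -- `D_Y ↦ D_Y`
    refine le_antisymm (T.map_transport_DY_le h (hq M') (hKL M M' h) α'.e α'.map_D ψ hψ) ?_
    have hle := T.map_transport_DY_le h (hq M') (hKL M M' h) α'.e.symm
      ((T.level M').iso_map_D_symm α') ψ.symm hψ'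
    intro d hd
    exact ⟨TopOut.transport ψ.symm d, hle ⟨d, hd, rfl⟩,
      by rw [← ψ.symm_symm]; exact ThetaEnvData.transport_symm_transport ψ.symm d⟩
  · change (fun H : Subgroup (T.level M).env => H.map ψ.toMulEquiv.toMonoidHom) ''
        CycEnvelope.muConjClass (T.level M).augY (T.level M).chi
          ((T.level M).sTheta (T.red_cocycle_mem M M' h η₀' hη₀')).range =
      CycEnvelope.muConjClass (T.level M).augY (T.level M).chi
        ((T.level M).sTheta (T.red_cocycle_mem M M' h η' hη')).range
    rw [CycEnvelope.image_muConjClass_eq_of_perm _ _ ψ.toMulEquiv (fun a => ⟨a ^ k, hpow a⟩)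
      (fun b => (hsurj b).imp fun a ha => (hpow a).trans (congrArg _ ha)), hrange,
      muConjClass_conj_eq]

/-- **`Cor218_iv_reduction` DISCHARGED modulo temp-slimness of `Π^tp_X` and Kummer lifting**: every
automorphism of the model `M_{M'}(η')` induces one of the model `M_M(red ∘ η')` (`M ∣ M'`).
[cite: MochizukiEtTh2009, Cor 2.18(iv) p.61] -/
theorem cor218_iv_reduction_of
    (hts : ∀ U : Subgroup T.PiX, IsOpen (U : Set T.PiX) →
      ∀ z : T.PiX, (∀ u ∈ U, z * u = u * z) → z = 1)
    (hKL : ∀ (M M' : E) (h : (M : ℕ+) ∣ M') (δ : T.G → T.mu M)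
      (hδ : CycEnvelope.IsEnvCocycle (T.level M).augY (T.level M).chi (δ ∘ (T.level M).augY)),
      CycEnvelope.shift hδ ∈ contMulAut (T.level M).env →
      ∃ (δ' : T.G → T.mu M')
        (hδ' : CycEnvelope.IsEnvCocycle (T.level M').augY (T.level M').chi (δ' ∘ (T.level M').augY)),
        CycEnvelope.shift hδ' ∈ contMulAut (T.level M').env ∧ ∀ g, T.red M M' h (δ' g) = δ g) :
    T.Cor218_iv_reduction := fun M M' h η' hη' α' =>
  T.exists_iso_reduces hts hKL M M' h η' η' hη' hη' α'

/-- **Corollary 2.19 (ii) (Discrete Rigidity) — DISCHARGED modulo temp-slimness of `Π^tp_X`, Kummer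
lifting, and the Cor 2.18 (iv) named facts `Cor218_iv_surjective`, `Cor218_iv_fibre` (first clause) at
every level** (the Cor 2.18 (iii) inputs and `Cor218_iv_reduction` being now theorems).
[cite: MochizukiEtTh2009, Cor 2.19(ii) p.64] -/
theorem cor219_ii_of_tempSlim_kummerLift
    (hts : ∀ U : Subgroup T.PiX, IsOpen (U : Set T.PiX) →
      ∀ z : T.PiX, (∀ u ∈ U, z * u = u * z) → z = 1)
    (hKL : ∀ (M M' : E) (h : (M : ℕ+) ∣ M') (δ : T.G → T.mu M)
      (hδ : CycEnvelope.IsEnvCocycle (T.level M).augY (T.level M).chi (δ ∘ (T.level M).augY)),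
      CycEnvelope.shift hδ ∈ contMulAut (T.level M).env →
      ∃ (δ' : T.G → T.mu M')
        (hδ' : CycEnvelope.IsEnvCocycle (T.level M').augY (T.level M').chi (δ' ∘ (T.level M').augY)),
        CycEnvelope.shift hδ' ∈ contMulAut (T.level M').env ∧ ∀ g, T.red M M' h (δ' g) = δ g)
    (hlift : ∀ (M : E) (η : T.PiYdd → T.mu M) (hη : η ∈ T.thetaCocycles M) (γ : T.PiX ≃ₜ* T.PiX),
      T.PiY.map γ.toMulEquiv.toMonoidHom = T.PiY →
      ∃ α : ((T.level M).modelMono hη).Iso ((T.level M).modelMono hη),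
        ∀ x, ((CycEnvelope.proj (T.level M).augY (T.level M).chi (α.e x) : T.PiY) : T.PiX) =
          γ (CycEnvelope.proj (T.level M).augY (T.level M).chi x : T.PiY))
    (hfib : ∀ (M : E) (η : T.PiYdd → T.mu M) (hη : η ∈ T.thetaCocycles M)
      (α : ((T.level M).modelMono hη).Iso ((T.level M).modelMono hη)),
      (∀ x, CycEnvelope.proj (T.level M).augY (T.level M).chi (α.e x) =
        CycEnvelope.proj (T.level M).augY (T.level M).chi x) →
      ∃ (φ : T.PiY →* T.mu M) (_ : ∀ g : T.PiYdd, φ ((T.level M).inclYdd g) = 1) (c : T.mu M),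
        ∀ x : (T.level M).env, α.e x =
          MulAut.conj (CycEnvelope.inMu (T.level M).augY (T.level M).chi c)
            (CycEnvelope.inMu (T.level M).augY (T.level M).chi
              (φ (CycEnvelope.proj (T.level M).augY (T.level M).chi x)) * x)) :
    T.Cor219_ii :=
  T.cor219_ii_of_tempSlim hts hlift hfib (T.cor218_iv_reduction_of hts hKL)

end ThetaEnvTower

end Literature.AnabelianGeometry.EtaleTheta
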